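import Mathlib
import HarnessLib
import Summits.NavierStokesRegularity.NavierStokesRegularity.Theorems.PoloidalWindowDoorLrcModEntireShearedSecondOrder

/-!
# Route `PoloidalWindowDoor`, item `LrcModEntire` (stmt-NavierStokesRegularity-20428), cell (Q4-sonic), slot `stub_Q4sonicLineNeg`, case I —
# B2: THE COEFFICIENTS OF THE SHEARED MIXED SYSTEM ARE SMOOTH ON THE TUBE (the `hdz`, `hα₂ … hα₈` inputs of the LEAD's template)

Cell ns-regularity-ideate, helper seat ns-k2-port-2 g8 under the LEAD of item 20428 (ns-poloidal-K2-p3 g17; template `…SheetSystemMixed.eq_zero_of_mixedSystem_template`,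
rows hR1/hR2 = `…ShearedKinematics`, hR3 = `…ShearedVerticalRow.verticalRow_template`); `--supports stmt-NavierStokesRegularity-20428 --as helper`.  Class-free.

Setting: `uncurry U ∈ C^∞(T × ℝ³)` (`T` open), `uncurry μ ∈ C^∞(Dμ)` (`Dμ ⊆ ℝ²` open — on the case-I window this follows from `…SlopeSmooth`), `d ∈ C^∞(D)` (`D` open),
`O` open with `t ∈ T`, `(t,z) ∈ Dμ ∩ D` and `μ(t,z) ≠ 1` over `O`; `Φ = shearMap e d`.  Building blocks (`ContDiffOn ℝ ∞ · (tube O)`):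
`p ↦ U(t, shearPt p)ᵢ`, `p ↦ D(U t)(shearPt p)[v]₂` (any fixed `v`), `p ↦ μ(t,z)`, `∂_zμ`, `∂_z²μ`, `∂_tμ`, `p ↦ Dd(t,z)[v]`, `g, P, Q`, `1/(1−μ)`;
then ★ `template_coeffs_smooth`: the coefficient functions `dz, α₂, …, α₈` of `verticalRow_template` (written as the same lambdas) are `C^∞` on the tube.
WHAT THIS IS NOT: not a claim about Navier–Stokes regularity; no stub is closed here; items 20428 / 19708 / 27893 OPEN.
-/

noncomputable section

set_option linter.dupNamespace false
set_option linter.style.longLine false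

namespace Summit.NavierStokesRegularity.NavierStokesRegularity.Theorems.PoloidalWindowDoorLrcModEntireShearedTemplateCoeffs

open Set Function Filter Topology
open scoped ContDiff
open Summit.NavierStokesRegularity.NavierStokesRegularity.Theorems.PoloidalWindowDoorLrcModEntireSheetSystemUniqueness
open Summit.NavierStokesRegularity.NavierStokesRegularity.Theorems.PoloidalWindowDoorLrcModEntireSheetFlattenTools
open Summit.NavierStokesRegularity.NavierStokesRegularity.Theorems.PoloidalWindowDoorLrcModEntireShearedCoordinates
open Summit.NavierStokesRegularity.NavierStokesRegularity.Theorems.PoloidalWindowDoorLrcModEntireShearedKinematics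
open Summit.NavierStokesRegularity.NavierStokesRegularity.Theorems.PoloidalWindowDoorLrcModEntireShearedSecondOrder

variable {U : ℝ → E3 → E3} {μ : ℝ → ℝ → ℝ} {e : E3} {T : Set ℝ} {O : Set Y3} {D Dμ : Set (ℝ × ℝ)} {d : ℝ × ℝ → ℝ}

/-! ### Slice derivatives of a function of two real variables -/

/-- `deriv (z ↦ G(t,z)) z = DG(t,z)[(0,1)]`. -/
theorem deriv_slice_snd {G : ℝ × ℝ → ℝ} {t z : ℝ} (hG : DifferentiableAt ℝ G (t, z)) :
    deriv (fun z' => G (t, z')) z = fderiv ℝ G (t, z) ((0 : ℝ), (1 : ℝ)) := by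
  have h := hG.hasFDerivAt.comp_hasDerivAt z ((hasDerivAt_const z t).prodMk (hasDerivAt_id z))
  exact h.deriv

/-- `deriv (s ↦ G(s,z)) t = DG(t,z)[(1,0)]`. -/
theorem deriv_slice_fst {G : ℝ × ℝ → ℝ} {t z : ℝ} (hG : DifferentiableAt ℝ G (t, z)) :
    deriv (fun s => G (s, z)) t = fderiv ℝ G (t, z) ((1 : ℝ), (0 : ℝ)) := by
  have h := hG.hasFDerivAt.comp_hasDerivAt t ((hasDerivAt_id t).prodMk (hasDerivAt_const t z))
  exact h.deriv

/-! ### Building blocks on the tube -/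

/-- `(t,z) ↦ H(t,z)` pulled back to the tube is smooth when `H` is smooth on an open set containing the `(t,z)`-range of `O`. -/
theorem contDiffOn_tz {H : ℝ × ℝ → ℝ} (hDμ : IsOpen Dμ) (hH : ContDiffOn ℝ ∞ H Dμ) (hOμ : ∀ y ∈ O, (y.1, y.2.2) ∈ Dμ) :
    ContDiffOn ℝ ∞ (fun p : Y3 × ℝ => H (p.1.1, p.1.2.2)) (tube O) := by
  intro p hp
  have hq : tzL p ∈ Dμ := by rw [tzL_apply]; exact hOμ p.1 hp
  have h := (hH.contDiffAt (hDμ.mem_nhds hq)).comp p tzL.contDiff.contDiffAt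
  exact h.contDiffWithinAt

/-- The components of `U` at the sheared point are smooth on the tube. -/
theorem contDiffOn_U_comp (hT : IsOpen T) (hW : ContDiffOn ℝ ∞ (uncurry U) (T ×ˢ (univ : Set E3))) (hOT : ∀ y ∈ O, y.1 ∈ T)
    (hD : IsOpen D) (hd : ContDiffOn ℝ ∞ d D) (hOD : ∀ y ∈ O, (y.1, y.2.2) ∈ D) (i : Fin 3) :
    ContDiffOn ℝ ∞ (fun p : Y3 × ℝ => U p.1.1 (shearPt e d p) i) (tube O) := by
  have hF : ContDiffOn ℝ ∞ (fun q : ℝ × E3 => uncurry U q i) (T ×ˢ (univ : Set E3)) :=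
    (EuclideanSpace.proj (𝕜 := ℝ) i).contDiff.comp_contDiffOn hW
  have h := contDiffOn_comp_shearMap (e := e) (F := fun q : ℝ × E3 => uncurry U q i) hT hF hOT hD hd hOD
  exact h.congr fun p _ => by simp [shearMap]

/-- `p ↦ D(U t)(shearPt p)[v]₂` is smooth on the tube (it is `gST (uncurry U) v ∘ Φ` there). -/
theorem contDiffOn_dU_comp (hT : IsOpen T) (hW : ContDiffOn ℝ ∞ (uncurry U) (T ×ˢ (univ : Set E3))) (hOT : ∀ y ∈ O, y.1 ∈ T)
    (hD : IsOpen D) (hd : ContDiffOn ℝ ∞ d D) (hOD : ∀ y ∈ O, (y.1, y.2.2) ∈ D) (v : E3) :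
    ContDiffOn ℝ ∞ (fun p : Y3 × ℝ => fderiv ℝ (U p.1.1) (shearPt e d p) v 2) (tube O) := by
  have hgs := (contDiffOn_gST_PST_QST (e := v) hT hW).1
  have h := contDiffOn_comp_shearMap (e := e) (F := gST (uncurry U) v) hT hgs hOT hD hd hOD
  refine h.congr fun p hp => ?_
  show fderiv ℝ (U p.1.1) (shearPt e d p) v 2 = gST (uncurry U) v (p.1.1, shearPt e d p)
  rw [gST_slice hT hW (hOT p.1 hp)]
  rfl

/-- `g, P, Q` are smooth on the tube. -/
theorem contDiffOn_gPQ (hT : IsOpen T) (hW : ContDiffOn ℝ ∞ (uncurry U) (T ×ˢ (univ : Set E3))) (hOT : ∀ y ∈ O, y.1 ∈ T)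
    (hD : IsOpen D) (hd : ContDiffOn ℝ ∞ d D) (hOD : ∀ y ∈ O, (y.1, y.2.2) ∈ D) :
    ContDiffOn ℝ ∞ (gST (uncurry U) e ∘ shearMap e d) (tube O) ∧ ContDiffOn ℝ ∞ (PST (uncurry U) e ∘ shearMap e d) (tube O) ∧
      ContDiffOn ℝ ∞ (QST (uncurry U) e ∘ shearMap e d) (tube O) := by
  obtain ⟨hg, hP, hQ⟩ := contDiffOn_gST_PST_QST (e := e) hT hW
  exact ⟨contDiffOn_comp_shearMap hT hg hOT hD hd hOD, contDiffOn_comp_shearMap hT hP hOT hD hd hOD, contDiffOn_comp_shearMap hT hQ hOT hD hd hOD⟩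

/-- The slope `μ(t,z)` and its derivatives `∂_zμ, ∂_z²μ, ∂_tμ` pulled back to the tube are smooth (`uncurry μ ∈ C^∞(Dμ)`). -/
theorem contDiffOn_slope (hDμ : IsOpen Dμ) (hμs : ContDiffOn ℝ ∞ (uncurry μ) Dμ) (hOμ : ∀ y ∈ O, (y.1, y.2.2) ∈ Dμ) :
    ContDiffOn ℝ ∞ (fun p : Y3 × ℝ => μ p.1.1 p.1.2.2) (tube O) ∧
      ContDiffOn ℝ ∞ (fun p : Y3 × ℝ => deriv (μ p.1.1) p.1.2.2) (tube O) ∧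
      ContDiffOn ℝ ∞ (fun p : Y3 × ℝ => deriv (deriv (μ p.1.1)) p.1.2.2) (tube O) ∧
      ContDiffOn ℝ ∞ (fun p : Y3 × ℝ => deriv (fun s => μ s p.1.2.2) p.1.1) (tube O) := by
  set M : ℝ × ℝ → ℝ := uncurry μ with hM
  have hDM : ContDiffOn ℝ ∞ (fderiv ℝ M) Dμ := hμs.fderiv_of_isOpen hDμ (by simp)
  -- first `z`-derivative as a smooth function on `Dμ`
  set M1 : ℝ × ℝ → ℝ := fun r => fderiv ℝ M r ((0 : ℝ), (1 : ℝ)) with hM1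
  have hM1s : ContDiffOn ℝ ∞ M1 Dμ := hDM.clm_apply contDiffOn_const
  have hDM1 : ContDiffOn ℝ ∞ (fderiv ℝ M1) Dμ := hM1s.fderiv_of_isOpen hDμ (by simp)
  set M2 : ℝ × ℝ → ℝ := fun r => fderiv ℝ M1 r ((0 : ℝ), (1 : ℝ)) with hM2
  have hM2s : ContDiffOn ℝ ∞ M2 Dμ := hDM1.clm_apply contDiffOn_const
  set Mt : ℝ × ℝ → ℝ := fun r => fderiv ℝ M r ((1 : ℝ), (0 : ℝ)) with hMt
  have hMts : ContDiffOn ℝ ∞ Mt Dμ := hDM.clm_apply contDiffOn_const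
  have hMd : ∀ r ∈ Dμ, DifferentiableAt ℝ M r := fun r hr => (hμs.contDiffAt (hDμ.mem_nhds hr)).differentiableAt (by simp)
  have hM1d : ∀ r ∈ Dμ, DifferentiableAt ℝ M1 r := fun r hr => (hM1s.contDiffAt (hDμ.mem_nhds hr)).differentiableAt (by simp)
  -- slice identities on `Dμ`
  have h1 : ∀ r ∈ Dμ, deriv (μ r.1) r.2 = M1 r := fun r hr => deriv_slice_snd (G := M) (hMd r hr)
  have h1' : ∀ r ∈ Dμ, deriv (μ r.1) =ᶠ[𝓝 r.2] fun z' => M1 (r.1, z') := by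
    intro r hr
    have hopen : {z' : ℝ | (r.1, z') ∈ Dμ} ∈ 𝓝 r.2 :=
      (continuous_const.prodMk continuous_id).continuousAt.preimage_mem_nhds (hDμ.mem_nhds (by simpa using hr))
    filter_upwards [hopen] with z' hz' using h1 (r.1, z') hz'
  have h2 : ∀ r ∈ Dμ, deriv (deriv (μ r.1)) r.2 = M2 r := by
    intro r hr
    rw [(h1' r hr).deriv_eq]
    exact deriv_slice_snd (G := M1) (hM1d r hr)
  have ht : ∀ r ∈ Dμ, deriv (fun s => μ s r.2) r.1 = Mt r := fun r hr => deriv_slice_fst (G := M) (hMd r hr)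
  refine ⟨?_, ?_, ?_, ?_⟩
  · exact (contDiffOn_tz (H := M) hDμ hμs hOμ).congr fun p _ => by simp [hM]
  · exact (contDiffOn_tz (H := M1) hDμ hM1s hOμ).congr fun p hp => h1 (p.1.1, p.1.2.2) (hOμ p.1 hp)
  · exact (contDiffOn_tz (H := M2) hDμ hM2s hOμ).congr fun p hp => h2 (p.1.1, p.1.2.2) (hOμ p.1 hp)
  · exact (contDiffOn_tz (H := Mt) hDμ hMts hOμ).congr fun p hp => ht (p.1.1, p.1.2.2) (hOμ p.1 hp)

/-- The derivatives of the offset `d` pulled back to the tube are smooth. -/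
theorem contDiffOn_dd (hD : IsOpen D) (hd : ContDiffOn ℝ ∞ d D) (hOD : ∀ y ∈ O, (y.1, y.2.2) ∈ D) (v : ℝ × ℝ) :
    ContDiffOn ℝ ∞ (fun p : Y3 × ℝ => fderiv ℝ d (p.1.1, p.1.2.2) v) (tube O) :=
  contDiffOn_tz (H := fun r => fderiv ℝ d r v) hD ((hd.fderiv_of_isOpen hD (by simp)).clm_apply contDiffOn_const) hOD

/-- ★ **The coefficients `dz, α₂, …, α₈` of `…ShearedVerticalRow.verticalRow_template` are `C^∞` on the tube.** -/
theorem template_coeffs_smooth (hT : IsOpen T) (hW : ContDiffOn ℝ ∞ (uncurry U) (T ×ˢ (univ : Set E3))) (hOT : ∀ y ∈ O, y.1 ∈ T)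
    (hDμ : IsOpen Dμ) (hμs : ContDiffOn ℝ ∞ (uncurry μ) Dμ) (hOμ : ∀ y ∈ O, (y.1, y.2.2) ∈ Dμ) (hμ1 : ∀ y ∈ O, μ y.1 y.2.2 ≠ 1)
    (hD : IsOpen D) (hd : ContDiffOn ℝ ∞ d D) (hOD : ∀ y ∈ O, (y.1, y.2.2) ∈ D) :
    ContDiffOn ℝ ∞ (fun p : Y3 × ℝ => fderiv ℝ d (p.1.1, p.1.2.2) ((0 : ℝ), (1 : ℝ))) (tube O) ∧
    ContDiffOn ℝ ∞ (fun p : Y3 × ℝ => 1 / (1 - μ p.1.1 p.1.2.2)) (tube O) ∧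
    ContDiffOn ℝ ∞ (fun p : Y3 × ℝ =>
      ((1 - μ p.1.1 p.1.2.2) * U p.1.1 (shearPt e d p) 2 + 2 * deriv (μ p.1.1) p.1.2.2) / (1 - μ p.1.1 p.1.2.2) ^ 2) (tube O) ∧
    ContDiffOn ℝ ∞ (fun p : Y3 × ℝ => (U p.1.1 (shearPt e d p) 0 * e 0 + U p.1.1 (shearPt e d p) 1 * e 1) / (1 - μ p.1.1 p.1.2.2)) (tube O) ∧
    ContDiffOn ℝ ∞ (fun p : Y3 × ℝ =>
      ((1 - μ p.1.1 p.1.2.2) * ((U p.1.1 (shearPt e d p) 1 * e 0 - U p.1.1 (shearPt e d p) 0 * e 1)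
          - fderiv ℝ d (p.1.1, p.1.2.2) ((1 : ℝ), (0 : ℝ)) - U p.1.1 (shearPt e d p) 2 * fderiv ℝ d (p.1.1, p.1.2.2) ((0 : ℝ), (1 : ℝ)))
        - 2 * deriv (μ p.1.1) p.1.2.2 * fderiv ℝ d (p.1.1, p.1.2.2) ((0 : ℝ), (1 : ℝ))) / (1 - μ p.1.1 p.1.2.2) ^ 2) (tube O) ∧
    ContDiffOn ℝ ∞ (fun p : Y3 × ℝ =>
      ((1 - μ p.1.1 p.1.2.2) * fderiv ℝ (U p.1.1) (shearPt e d p) e2 2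
        - (deriv (fun s => μ s p.1.2.2) p.1.1 + U p.1.1 (shearPt e d p) 2 * deriv (μ p.1.1) p.1.2.2 - deriv (deriv (μ p.1.1)) p.1.2.2))
        / (1 - μ p.1.1 p.1.2.2) ^ 2) (tube O) ∧
    ContDiffOn ℝ ∞ (fun p : Y3 × ℝ => (gST (uncurry U) e ∘ shearMap e d) p / (1 - μ p.1.1 p.1.2.2)) (tube O) ∧
    ContDiffOn ℝ ∞ (fun p : Y3 × ℝ => fderiv ℝ (U p.1.1) (shearPt e d p) (Jvec e) 2 / (1 - μ p.1.1 p.1.2.2)) (tube O) := by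
  obtain ⟨hμ0, hμz, hμzz, hμt⟩ := contDiffOn_slope (O := O) hDμ hμs hOμ
  have hU := fun i => contDiffOn_U_comp (e := e) hT hW hOT hD hd hOD i
  have hdU := fun v => contDiffOn_dU_comp (e := e) hT hW hOT hD hd hOD v
  obtain ⟨hg, -, -⟩ := contDiffOn_gPQ (e := e) hT hW hOT hD hd hOD
  have hdz := contDiffOn_dd (O := O) hD hd hOD ((0 : ℝ), (1 : ℝ))
  have hdt := contDiffOn_dd (O := O) hD hd hOD ((1 : ℝ), (0 : ℝ))
  have hν : ContDiffOn ℝ ∞ (fun p : Y3 × ℝ => 1 - μ p.1.1 p.1.2.2) (tube O) := contDiffOn_const.sub hμ0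
  have hν0 : ∀ p ∈ tube O, (1 - μ p.1.1 p.1.2.2) ≠ 0 := fun p hp => sub_ne_zero.2 (Ne.symm (hμ1 p.1 hp))
  have hν2 : ContDiffOn ℝ ∞ (fun p : Y3 × ℝ => (1 - μ p.1.1 p.1.2.2) ^ 2) (tube O) := hν.pow 2
  have hν20 : ∀ p ∈ tube O, (1 - μ p.1.1 p.1.2.2) ^ 2 ≠ 0 := fun p hp => pow_ne_zero 2 (hν0 p hp)
  have hc : ∀ c : ℝ, ContDiffOn ℝ ∞ (fun _ : Y3 × ℝ => c) (tube O) := fun c => contDiffOn_const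
  refine ⟨hdz, (hc 1).div hν hν0, ?_, ?_, ?_, ?_, hg.div hν hν0, (hdU (Jvec e)).div hν hν0⟩
  · exact ((hν.mul (hU 2)).add ((hc 2).mul hμz)).div hν2 hν20
  · exact (((hU 0).mul (hc _)).add ((hU 1).mul (hc _))).div hν hν0
  · exact ((hν.mul ((((hU 1).mul (hc _)).sub ((hU 0).mul (hc _))).sub hdt |>.sub ((hU 2).mul hdz))).sub
      (((hc 2).mul hμz).mul hdz)).div hν2 hν20
  · exact ((hν.mul (hdU e2)).sub ((hμt.add ((hU 2).mul hμz)).sub hμzz)).div hν2 hν20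

end Summit.NavierStokesRegularity.NavierStokesRegularity.Theorems.PoloidalWindowDoorLrcModEntireShearedTemplateCoeffs
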